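import Literature.Probability.Distributions.GaussianVectorMaxTail
import Summits.QuantumFields.YangMills.Theorems.FluctuationComparisonRegPrIntLS2BetaNeumannFRD
import Summits.QuantumFields.YangMills.Theorems.FluctuationComparisonRegPrIntLSupTailModulus
import HarnessLib

/-!
# `FluctuationComparisonRegPrIntLTailSupOneGaussianTail` — LINE g21-2 «DEPTH-ONE WINDOW ODDS BY A MEASURE SPLIT»: THE GAUSSIAN PROXY OF MOD₁, BY KERNEL
# (crux `UnitScaleTilt.FluctuationComparisonRegPrIntL`, stmt-QuantumFields-20520; rows MOD₁ `ModerateFieldOddsDepthOneCan` of `Cruxes/…/Lines/tailsup_one.lean` and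
# TAILSUP₁ ∕ TAILSUP of `Lines/suptail_split.lean`, ideator ym-r3-idea-1 g21; crux idea #158 `neumann-frd-step` supplies the comparison covariance)

Cell `ym3-torus` (YM ladder rung R3 = continuum SU(2) Yang–Mills on T³ — a RUNG, NOT the Clay problem: not d = 4, not infinite volume, not a mass gap);
width seat `ym-ust-20520-w3` (gen 17); helper `--supports stmt-QuantumFields-20520`.  THEOREMS ONLY (0 `def`, 0 `sorry`, default heartbeats).

WHAT.  The card of LINE g21-2 names MOD₁'s first lemma: «the fibre Gaussian tail `∫_{|v_p| ≥ θ} e^{−½⟨v,Hv⟩} ≤ N e^{−cθ²λ_min(H)} ∫ e^{−½⟨v,Hv⟩}` with the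
NeumannFRD covariance as comparison quadratic form».  In the currency of Mathlib's centred multivariate Gaussian `N(0, S)` on `ℝ^ι` this file proves it from a
UNIFORM LOWER BOUND ONLY (no spectral theorem):
* §1 ★`dotProduct_inv_mulVec_le_of_coercive` — `m‖z‖² ≤ zᵀMz` for all `z` (`m > 0`) ⇒ for EVERY `ℓ`: `0 ≤ ℓᵀM⁻¹ℓ ≤ ‖ℓ‖²∕m` (invertibility from
  ✓`…S2BetaNeumannFRD.isUnit_det_of_coercive`; with `w := M⁻¹ℓ`: `ℓᵀw = wᵀMw ≥ m‖w‖²` and Cauchy–Schwarz); `posDef_of_dotProduct_coercive`, `posSemidef_inv_of_dotProduct_coercive` (Hermitian case).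
* §2 ★★`gaussian_maxTail_of_coercive` — `N(0, M⁻¹){z | ∃ p ∈ s, t ≤ |ℓ_p·z|} ≤ 2·#s·exp(−m·t²∕(2R²))` whenever `‖ℓ_p‖² ≤ R²` on `s` (lit
  ✓`GaussianVectorMaxTail.measureReal_exists_abs_dotProduct_ge_le` with `v := R²∕m`).
* §3 ★★`gaussian_maxTail_coupling_cancels` — covariance `g²·M⁻¹` (the fluctuation field at coupling `g`), thresholds `g·t`: the SAME bound, `g`-free.  With the tree's
  profile `θBal L γ b₀ p₀ i = g_i·pFun b₀ p₀ g_i` this reads: the Gaussian window odds of «some level-`i` plaquette functional beyond `θ_i`» are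
  `≤ 2N_i·exp(−m·pFun(g_i)²∕(2R²))` — `gaussianWindowOdds_le`.
* §4 ★`gaussianWindowOdds_superpoly` — that modulus, with the per-height plaquette count `9·8L^{3m}(L^i)³`, is `≤ A'·(1∕2)^i` and its tail sums over the free
  levels `j > J` are `≤ A'·(1∕2)^J` (B ✓`sum_perHeight_le_geometric` at `A = 0`), hence super-polynomial (✓`superpoly_of_le_geometric`): the card's falsifier (b)
  («needs Bałaban's exponent `r > 1∕2`») PASSES in the tree's letters at `p₀ ≥ 1`.
HONEST SCOPE.  A Gaussian ∕ linear-algebra PROXY: the one-step constrained fibre law is NOT Gaussian, so this is not MOD₁ (whose content is the Laplace comparison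
on the constrained chart), not TAILSUP₁, not TAILSUP; LFR♯ᶜ, S2β, 20520, `YM3TorusSU2` NOT proved; the Yang–Mills mass gap is NOT proved.
References: [BoucheronLugosiMassart2013] §2.3, §2.5 (sub-Gaussian tails, maximal inequality); [Balaban1985UV3] (7) p. 257 (the profile `p(g)`), (38)–(40) p. 266
(positivity of the fluctuation operator for small fields).
-/

noncomputable section

set_option autoImplicit false

open MeasureTheory ProbabilityTheory Filter Topology Set Matrix
open scoped ENNReal NNReal BigOperators
open Literature.MathematicalPhysics.QuantumFieldTheory.Balaban1983to89
open Literature.MathematicalPhysics.QuantumFieldTheory.Balaban1983to89.T3ContinuumYM3Torus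
open Literature.MathematicalPhysics.QuantumFieldTheory.Balaban1983to89.T3UnitLawDensityEML
open Literature.MathematicalPhysics.QuantumFieldTheory.Balaban1983to89.T3UnitScaleTilt
open Literature.Probability.Distributions (measureReal_exists_abs_dotProduct_ge_le)
open Summit.QuantumFields.YangMills.Theorems.FluctuationComparisonRegPrIntLS2BetaNeumannFRD (isUnit_det_of_coercive)
open Summit.QuantumFields.YangMills.Theorems.FluctuationComparisonRegPrIntLSupTailModulus (sum_perHeight_le_geometric superpoly_of_le_geometric)

namespace Summit.QuantumFields.YangMills.Theorems.FluctuationComparisonRegPrIntLTailSupOneGaussianTail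

/-! ## §1 A uniform lower bound on the form controls the inverse form from above -/

section Coercive

variable {ι : Type*} [Fintype ι]

/-- A Hermitian matrix with a uniform lower bound `m‖z‖² ≤ zᵀMz`, `m > 0`, is positive definite. [folklore] -/
theorem posDef_of_dotProduct_coercive {M : Matrix ι ι ℝ} (hH : M.IsHermitian) {m : ℝ} (hm : 0 < m)
    (hlo : ∀ z : ι → ℝ, m * (z ⬝ᵥ z) ≤ z ⬝ᵥ M *ᵥ z) : M.PosDef := by
  refine Matrix.PosDef.of_dotProduct_mulVec_pos hH fun x hx => ?_
  have hxx : 0 < x ⬝ᵥ x := by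
    obtain ⟨i, hi⟩ : ∃ i, x i ≠ 0 := Function.ne_iff.mp hx
    simp only [dotProduct]
    exact Finset.sum_pos' (fun j _ => mul_self_nonneg _) ⟨i, Finset.mem_univ _, mul_self_pos.mpr hi⟩
  have : star x = x := star_trivial x
  rw [this]
  exact lt_of_lt_of_le (mul_pos hm hxx) (hlo x)

variable [DecidableEq ι]

/-- ★ **COERCIVITY BOUNDS THE INVERSE FORM**: if `m‖z‖² ≤ zᵀMz` for every `z` (`m > 0`) then for every `ℓ`, `0 ≤ ℓᵀM⁻¹ℓ ≤ ‖ℓ‖²∕m`.  No symmetry and no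
spectral theorem: `M` is invertible (✓`isUnit_det_of_coercive`), and with `w := M⁻¹ℓ` one has `Mw = ℓ`, `ℓᵀM⁻¹ℓ = (Mw)ᵀw ≥ m‖w‖² ≥ 0` and, by Cauchy–Schwarz,
`(ℓᵀw)² ≤ ‖ℓ‖²‖w‖² ≤ ‖ℓ‖²·(ℓᵀw)∕m`. [folklore] -/
theorem dotProduct_inv_mulVec_le_of_coercive (M : Matrix ι ι ℝ) {m : ℝ} (hm : 0 < m)
    (hlo : ∀ z : ι → ℝ, m * (z ⬝ᵥ z) ≤ z ⬝ᵥ M *ᵥ z) (ℓ : ι → ℝ) :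
    0 ≤ ℓ ⬝ᵥ M⁻¹ *ᵥ ℓ ∧ ℓ ⬝ᵥ M⁻¹ *ᵥ ℓ ≤ (ℓ ⬝ᵥ ℓ) / m := by
  have hdet : IsUnit M.det := isUnit_det_of_coercive M hm hlo
  set w : ι → ℝ := M⁻¹ *ᵥ ℓ with hw
  have hMw : M *ᵥ w = ℓ := by
    rw [hw, Matrix.mulVec_mulVec, Matrix.mul_nonsing_inv _ hdet, Matrix.one_mulVec]
  -- `ℓᵀw = wᵀMw ≥ m‖w‖²`
  have hform : ℓ ⬝ᵥ w = w ⬝ᵥ M *ᵥ w := by rw [← hMw, dotProduct_comm]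
  have hlow : m * (w ⬝ᵥ w) ≤ ℓ ⬝ᵥ w := hform ▸ hlo w
  have hww : 0 ≤ w ⬝ᵥ w := by
    simp only [dotProduct]
    exact Finset.sum_nonneg fun i _ => mul_self_nonneg _
  have h0 : 0 ≤ ℓ ⬝ᵥ w := le_trans (mul_nonneg hm.le hww) hlow
  refine ⟨h0, ?_⟩
  -- Cauchy–Schwarz: `(ℓᵀw)² ≤ ‖ℓ‖²‖w‖² ≤ ‖ℓ‖²·(ℓᵀw)/m`
  have hℓℓ : 0 ≤ ℓ ⬝ᵥ ℓ := by
    simp only [dotProduct]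
    exact Finset.sum_nonneg fun i _ => mul_self_nonneg _
  have hcs : (ℓ ⬝ᵥ w) ^ 2 ≤ (ℓ ⬝ᵥ ℓ) * (w ⬝ᵥ w) := by
    -- Cauchy–Schwarz for `dotProduct` (folklore, inlined)
    have h := Finset.sum_mul_sq_le_sq_mul_sq Finset.univ ℓ w
    simp only [dotProduct, ← sq]
    exact h
  have hww' : w ⬝ᵥ w ≤ (ℓ ⬝ᵥ w) / m := by
    rw [le_div_iff₀ hm, mul_comm]
    exact hlow
  have hsq : (ℓ ⬝ᵥ w) ^ 2 ≤ (ℓ ⬝ᵥ ℓ) * ((ℓ ⬝ᵥ w) / m) := hcs.trans (mul_le_mul_of_nonneg_left hww' hℓℓ)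
  -- divide by `ℓᵀw` when positive; trivial when it vanishes
  rcases h0.lt_or_eq with hpos | hzero
  · have : (ℓ ⬝ᵥ w) * (ℓ ⬝ᵥ w) ≤ ((ℓ ⬝ᵥ ℓ) / m) * (ℓ ⬝ᵥ w) := by
      calc (ℓ ⬝ᵥ w) * (ℓ ⬝ᵥ w) = (ℓ ⬝ᵥ w) ^ 2 := (sq _).symm
        _ ≤ (ℓ ⬝ᵥ ℓ) * ((ℓ ⬝ᵥ w) / m) := hsq
        _ = ((ℓ ⬝ᵥ ℓ) / m) * (ℓ ⬝ᵥ w) := by ring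
    exact le_of_mul_le_mul_right this hpos
  · rw [← hzero]
    exact div_nonneg hℓℓ hm.le

/-- The inverse of a Hermitian uniformly coercive matrix is positive semidefinite (a legitimate Gaussian covariance). [folklore] -/
theorem posSemidef_inv_of_dotProduct_coercive {M : Matrix ι ι ℝ} (hH : M.IsHermitian) {m : ℝ} (hm : 0 < m)
    (hlo : ∀ z : ι → ℝ, m * (z ⬝ᵥ z) ≤ z ⬝ᵥ M *ᵥ z) : M⁻¹.PosSemidef :=
  (posDef_of_dotProduct_coercive hH hm hlo).inv.posSemidef

end Coercive

/-! ## §2 The Gaussian max-tail under a coercive precision: `N(0, M⁻¹){∃ p, |ℓ_p·z| ≥ t} ≤ 2N·e^{−m t²/(2R²)}` -/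

section Gaussian

variable {ι : Type*} [Fintype ι] [DecidableEq ι]

/-- ★★ **THE GAUSSIAN MAX-TAIL UNDER A COERCIVE PRECISION MATRIX**: for a Hermitian `M` with `m‖z‖² ≤ zᵀMz` (`m > 0`), a finite family of functionals `ℓ_p`,
`p ∈ s`, with `‖ℓ_p‖² ≤ R²` (`R² > 0`) and a threshold `t ≥ 0`: `N(0, M⁻¹){z | ∃ p ∈ s, t ≤ |ℓ_p·z|} ≤ 2·#s·exp(−m·t²∕(2R²))` — the union bound of lit
✓`measureReal_exists_abs_dotProduct_ge_le` with every variance `ℓ_pᵀM⁻¹ℓ_p ≤ R²∕m` (§1). [cite: BoucheronLugosiMassart2013, §2.5; Balaban1985UV3, (38)-(40) p.266] -/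
theorem gaussian_maxTail_of_coercive {M : Matrix ι ι ℝ} (hH : M.IsHermitian) {m : ℝ} (hm : 0 < m)
    (hlo : ∀ z : ι → ℝ, m * (z ⬝ᵥ z) ≤ z ⬝ᵥ M *ᵥ z) {A : Type*} (s : Finset A) (ℓ : A → ι → ℝ) {Rsq : ℝ} (hR : 0 < Rsq)
    (hℓ : ∀ p ∈ s, ℓ p ⬝ᵥ ℓ p ≤ Rsq) {t : ℝ} (ht : 0 ≤ t) :
    (multivariateGaussian 0 M⁻¹).real {z : EuclideanSpace ℝ ι | ∃ p ∈ s, t ≤ |∑ i, ℓ p i * z i|} ≤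
      2 * s.card * Real.exp (-(m * t ^ 2 / (2 * Rsq))) := by
  have hS : M⁻¹.PosSemidef := posSemidef_inv_of_dotProduct_coercive hH hm hlo
  have hvm : (0 : ℝ) ≤ Rsq / m := div_nonneg hR.le hm.le
  have hvar : ∀ p ∈ s, ℓ p ⬝ᵥ M⁻¹ *ᵥ ℓ p ≤ ((Rsq / m).toNNReal : ℝ) := by
    intro p hp
    rw [Real.coe_toNNReal _ hvm]
    exact (dotProduct_inv_mulVec_le_of_coercive M hm hlo (ℓ p)).2.trans (div_le_div_of_nonneg_right (hℓ p hp) hm.le)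
  have h := measureReal_exists_abs_dotProduct_ge_le hS s ℓ hvar ht
  have hexp : -t ^ 2 / (2 * ((Rsq / m).toNNReal : ℝ)) = -(m * t ^ 2 / (2 * Rsq)) := by
    rw [Real.coe_toNNReal _ hvm]
    field_simp
  rw [hexp] at h
  exact h

/-- ★★ **THE COUPLING CANCELS**: at coupling `g ≠ 0` the fluctuation field has covariance `g²·M⁻¹` and the thresholds scale as `g·t` — the Gaussian max-tail is
the SAME `2·#s·exp(−m·t²∕(2R²))`, independent of `g`.  This is why Bałaban's thresholds are `θ(g) = g·p(g)`: in units of the fluctuation, only `p(g)` is seen.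
[cite: Balaban1985UV3, (7) p.257 and (38)-(40) p.266; BoucheronLugosiMassart2013, §2.5] -/
theorem gaussian_maxTail_coupling_cancels {M : Matrix ι ι ℝ} (hH : M.IsHermitian) {m : ℝ} (hm : 0 < m)
    (hlo : ∀ z : ι → ℝ, m * (z ⬝ᵥ z) ≤ z ⬝ᵥ M *ᵥ z) {A : Type*} (s : Finset A) (ℓ : A → ι → ℝ) {Rsq : ℝ} (hR : 0 < Rsq)
    (hℓ : ∀ p ∈ s, ℓ p ⬝ᵥ ℓ p ≤ Rsq) {g : ℝ} (hg : 0 < g) {t : ℝ} (ht : 0 ≤ t) :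
    (multivariateGaussian 0 (g ^ 2 • M⁻¹)).real {z : EuclideanSpace ℝ ι | ∃ p ∈ s, g * t ≤ |∑ i, ℓ p i * z i|} ≤
      2 * s.card * Real.exp (-(m * t ^ 2 / (2 * Rsq))) := by
  have hS : (g ^ 2 • M⁻¹).PosSemidef := (posSemidef_inv_of_dotProduct_coercive hH hm hlo).smul (sq_nonneg g)
  have hvm : (0 : ℝ) ≤ g ^ 2 * (Rsq / m) := mul_nonneg (sq_nonneg g) (div_nonneg hR.le hm.le)
  have hvar : ∀ p ∈ s, ℓ p ⬝ᵥ (g ^ 2 • M⁻¹) *ᵥ ℓ p ≤ ((g ^ 2 * (Rsq / m)).toNNReal : ℝ) := by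
    intro p hp
    rw [Real.coe_toNNReal _ hvm, Matrix.smul_mulVec, dotProduct_smul, smul_eq_mul]
    exact mul_le_mul_of_nonneg_left
      ((dotProduct_inv_mulVec_le_of_coercive M hm hlo (ℓ p)).2.trans (div_le_div_of_nonneg_right (hℓ p hp) hm.le)) (sq_nonneg g)
  have h := measureReal_exists_abs_dotProduct_ge_le hS s ℓ hvar (mul_nonneg hg.le ht)
  have hexp : -(g * t) ^ 2 / (2 * ((g ^ 2 * (Rsq / m)).toNNReal : ℝ)) = -(m * t ^ 2 / (2 * Rsq)) := by
    rw [Real.coe_toNNReal _ hvm]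
    field_simp
  rw [hexp] at h
  exact h

/-- **THE GAUSSIAN WINDOW ODDS AT LEVEL `i` IN THE TREE's PROFILE**: covariance `g_i²·M⁻¹` with `g_i = √(γL^{−i})`, thresholds `θBal L γ b₀ p₀ i = g_i·p(g_i)` —
the Gaussian odds that some plaquette functional of the family leaves the level-`i` window are `≤ 2·#s·exp(−m·pFun b₀ p₀ g_i²∕(2R²))` (`γ > 0`, `L ≥ 1`, `b₀ ≥ 0`).
[cite: Balaban1985UV3, (7) p.257 and (38)-(40) p.266] -/
theorem gaussianWindowOdds_le {M : Matrix ι ι ℝ} (hH : M.IsHermitian) {m : ℝ} (hm : 0 < m)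
    (hlo : ∀ z : ι → ℝ, m * (z ⬝ᵥ z) ≤ z ⬝ᵥ M *ᵥ z) {A : Type*} (s : Finset A) (ℓ : A → ι → ℝ) {Rsq : ℝ} (hR : 0 < Rsq)
    (hℓ : ∀ p ∈ s, ℓ p ⬝ᵥ ℓ p ≤ Rsq) {L : ℕ} (hL : 1 ≤ L) {γ b₀ : ℝ} (hγ : 0 < γ) (hγ1 : γ ≤ 1) (hb₀ : 0 ≤ b₀) (p₀ : ℝ) (i : ℕ) :
    (multivariateGaussian 0 ((Real.sqrt (γ * ((L : ℝ)⁻¹) ^ i)) ^ 2 • M⁻¹)).real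
        {z : EuclideanSpace ℝ ι | ∃ p ∈ s, θBal L γ b₀ p₀ i ≤ |∑ j, ℓ p j * z j|} ≤
      2 * s.card * Real.exp (-(m * B10.pFun b₀ p₀ (Real.sqrt (γ * ((L : ℝ)⁻¹) ^ i)) ^ 2 / (2 * Rsq))) := by
  have hLpos : (0 : ℝ) < L := by exact_mod_cast hL
  have hg : 0 < Real.sqrt (γ * ((L : ℝ)⁻¹) ^ i) := Real.sqrt_pos.mpr (mul_pos hγ (pow_pos (inv_pos.mpr hLpos) i))
  -- `g_i ≤ 1` (from `γ ≤ 1`, `L ≥ 1`), so `1 + log g_i⁻¹ ≥ 1 ≥ 0` and `p(g_i) ≥ 0`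
  have hLinv : ((L : ℝ)⁻¹) ^ i ≤ 1 := pow_le_one₀ (inv_nonneg.mpr hLpos.le) (inv_le_one_of_one_le₀ (by exact_mod_cast hL))
  have hg1 : Real.sqrt (γ * ((L : ℝ)⁻¹) ^ i) ≤ 1 := by
    rw [← Real.sqrt_one]
    exact Real.sqrt_le_sqrt (by nlinarith [pow_nonneg (inv_nonneg.mpr hLpos.le) i])
  have hp : 0 ≤ B10.pFun b₀ p₀ (Real.sqrt (γ * ((L : ℝ)⁻¹) ^ i)) := by
    unfold B10.pFun
    refine mul_nonneg hb₀ (Real.rpow_nonneg ?_ _)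
    have hlog : 0 ≤ Real.log (Real.sqrt (γ * ((L : ℝ)⁻¹) ^ i))⁻¹ := Real.log_nonneg ((one_le_inv₀ hg).mpr hg1)
    linarith
  unfold θBal
  exact gaussian_maxTail_coupling_cancels hH hm hlo s ℓ hR hℓ hg hp

end Gaussian

/-! ## §3 The Gaussian window-odds modulus is super-polynomial in the height (the card's falsifier (b) in the tree's letters) -/

section Modulus

/-- ★ **THE GAUSSIAN WINDOW-ODDS MODULUS, SUMMED OVER THE FREE LEVELS, IS `≤ A'·2^{−J}`**: with the per-height plaquette count `9·(8L^{3m}(L^j)³)` of the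
family and the Gaussian factor `2·e^{−(m∕2R²)·p(g_j)²}` of `gaussianWindowOdds_le` (print's per-plaquette currency at `A = 0`: `β_j^0 = 1`), every partial sum
over `J < j < N` is `≤ A'·(1∕2)^J` — B ✓`sum_perHeight_le_geometric` BY NAME (`0 < γ ≤ 1`, `0 < b₀`, `1 ≤ p₀`).  So the Gaussian proxy of TAILSUP's∕MOD₁'s
modulus satisfies `(J+1)^a·τ J → 0` for every `a` (✓`superpoly_of_le_geometric`): the falsifier «needs `r > 1∕2`» passes at the tree's `p₀ ≥ 1`.
[cite: Balaban1985UV3, (7) p.257 and (71) p.273] -/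
theorem gaussianWindowOdds_levelSum_le (F : T3Family) {γ b₀ p₀ : ℝ} (hγ : 0 < γ) (hγ1 : γ ≤ 1) (hb₀ : 0 < b₀) (hp₀ : 1 ≤ p₀)
    {m Rsq : ℝ} (hm : 0 < m) (hR : 0 < Rsq) (J N : ℕ) :
    ∑ j ∈ Finset.Ico (J + 1) N,
        (9 * (8 * (F.L : ℝ) ^ (3 * F.m) * ((F.L : ℝ) ^ j) ^ 3)) *
          (2 * (F.scheme ℰp γ).β j ^ 0 * Real.exp (-(m / (2 * Rsq) * B10.pFun b₀ p₀ (Real.sqrt (γ * ((F.L : ℝ)⁻¹) ^ j)) ^ 2))) ≤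
      (72 * 2 * (F.L : ℝ) ^ (3 * F.m) * γ⁻¹ ^ 0 *
          Real.exp ((((3 : ℝ) + (0 : ℕ)) * Real.log F.L + Real.log 2) ^ 2 / (4 * (m / (2 * Rsq) * b₀ ^ 2 * Real.log F.L ^ 2 / 4)))) *
        ((1 : ℝ) / 2) ^ J :=
  sum_perHeight_le_geometric F hγ hγ1 hb₀ hp₀ (C := 2) (by norm_num) 0 (c := m / (2 * Rsq)) (by positivity) J N

/-- **SUPER-POLYNOMIAL**: any modulus `0 ≤ τ J` dominated by the level sums of `gaussianWindowOdds_levelSum_le` (hence by `A'·(1∕2)^J`) satisfies TAILSUP's clause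
`∀ a, (J+1)^a·τ J → 0`. [folklore] -/
theorem gaussianWindowOdds_superpoly (F : T3Family) {γ b₀ p₀ : ℝ} (hγ : 0 < γ) (hγ1 : γ ≤ 1) (hb₀ : 0 < b₀) (hp₀ : 1 ≤ p₀)
    {m Rsq : ℝ} (hm : 0 < m) (hR : 0 < Rsq) {τ : ℕ → ℝ} (h0 : ∀ J, 0 ≤ τ J)
    (hle : ∀ J, ∃ N, τ J ≤ ∑ j ∈ Finset.Ico (J + 1) N,
        (9 * (8 * (F.L : ℝ) ^ (3 * F.m) * ((F.L : ℝ) ^ j) ^ 3)) *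
          (2 * (F.scheme ℰp γ).β j ^ 0 * Real.exp (-(m / (2 * Rsq) * B10.pFun b₀ p₀ (Real.sqrt (γ * ((F.L : ℝ)⁻¹) ^ j)) ^ 2)))) (a : ℕ) :
    Tendsto (fun J : ℕ => ((J : ℝ) + 1) ^ a * τ J) atTop (𝓝 0) := by
  refine superpoly_of_le_geometric
    (A' := 72 * 2 * (F.L : ℝ) ^ (3 * F.m) * γ⁻¹ ^ 0 *
      Real.exp ((((3 : ℝ) + (0 : ℕ)) * Real.log F.L + Real.log 2) ^ 2 / (4 * (m / (2 * Rsq) * b₀ ^ 2 * Real.log F.L ^ 2 / 4))))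
    h0 (fun J => ?_) a
  obtain ⟨N, hN⟩ := hle J
  exact hN.trans (gaussianWindowOdds_levelSum_le F hγ hγ1 hb₀ hp₀ hm hR J N)

end Modulus

end Summit.QuantumFields.YangMills.Theorems.FluctuationComparisonRegPrIntLTailSupOneGaussianTail

end
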